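import Mathlib
import Summits.Ventures.PercRepro2.A3PendantFreeFibres
import Summits.Ventures.PercRepro2.HMFLeaf

/-!
# (MEANS-a₃) at a leaf `a₃` attached to an UNMARKED vertex `v`: the full-weight form is affine in the
mixing parameter between (MEANS-a₃) at `v` and the first-order functional (FM) at `v`
(blind cell PercRepro2, night-1 g31; proofs/NIGHT1-G31.md; the paper computation of NIGHT1-G29.md §5.1)

Let `a₃` be a leaf attached to `v ∉ {o, a₁, a₂, b}` by the edge `f` of weight `t = p f`, and let
`p₁ = p[f ↦ 1]` (the leaf pinned open: `a₃` rides with `v`).  The fibres of the `a₃`-exploration are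
`{a₃}` (`f` closed) and, for `W ∋ v`, the fibres of the `v`-exploration with `f` open
(`fibre_leaf_eq_of_mem`: `Q ∩ {C(a₃) = W} = Q ∩ {C(v) = W} ∩ {f open}`), so every fibre mass of `a₃`
at `W ∋ v` is `t` times the `v`-fibre mass under `p₁` (`mW_leaf_of_mem`, `Ssig_leaf_of_mem`,
`Su_leaf_of_mem`); every other fibre is null.  Hence, with `D = (1 − t) P(Q) + t D_v`
(`prob_PD_leaf_free`) and `s = (1 − t) P(Q) / D ∈ [0, 1]`,

  **`btw(a₃) = t · ((1 − s) · btw(v at p₁) + s · FMfun(v at p₁))`**   (`btw_leaf_free`, for `D ≠ 0`)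

where **`FMfun`** is the first-order functional (FM) of NIGHT1-G29 §5.1 in the fibre vocabulary: the
`v`-fibre form of `btw` with the centring `γ₀ = P(Q, o ∈ U)/P(Q)` in place of `γ` and the `PD`-part
replaced by its `t → 0` expansion `∑_A Su_b Su_o / m_W − (n_b m_o + n_o m_b)/P(Q) + D_v m_b m_o / P(Q)²`.
Consequently **`A3Between_leaf_free_of`**: (MEANS-a₃) at the leaf, at every weight of the leaf edge,
follows from (MEANS-a₃) at the smaller instance `v` (under `p₁`) together with `0 ≤ FMfun` at `v` —
the means-level twin of p1's leaf closure `LeafPlus.HCovPlus_leaf` (there: (HCOV)(v) ∧ (Q1)(v)); and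
`HCov_leaf_free_of` via `A3FibreMain.HCov_of_a3Between`.  The conditional-mean reading: `btw(a₃)/t
= P(Q)·Cov_ρ(f, g_t) − [PD-part]` with `ρ` the law of `C(v)`, and `γ_t = s γ₀ + (1 − s) γ₁` (§5.1's
`d_t`).  Standard axioms.
-/

namespace Summit.Ventures.PercRepro2

open UnionCluster CovForm PendantRoot PendantO

namespace CovForm

namespace A3Fibre

/-! ## The first-order functional (FM) at a vertex `v` -/

section FMDefs

variable {V : Type*} {E : Type*} [Fintype V] [DecidableEq V] [Fintype E] [DecidableEq E]
  {R : Type*} [Field R] [LinearOrder R]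

/-- `γ₀ = P(Q, o ∈ U) / P(Q)`: the unconditioned centring of `F` (the `t → 0` limit of `γ` at a leaf). -/
noncomputable def gamma0 (p : E → R) (ends : E → Sym2 V) (o a₁ a₂ : V) : R :=
  LeafStep.mU p ends a₁ a₂ o / prob p (avoidAll ends a₂ {a₁})

/-- **The first-order functional (FM) at the vertex `v`** (NIGHT1-G29 §5.1): the `v`-fibre form of
`btw` with the centring `γ₀` and the `PD`-part expanded to first order,
`∑_W Sb·SF⁰/m_W − (∑ Sb)(∑ SF⁰)/P(Q) − ∑_A Sub·Suo/m_W + (n_b m_o + n_o m_b)/P(Q) − D_v m_b m_o/P(Q)²`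
(`n_x = ∑_A Su_x`, `m_x = P(Q, x ∈ U)`, `D_v = P(PD_v)`). -/
noncomputable def FMfun (p : E → R) (ends : E → Sym2 V) (o a₁ a₂ v b : V) : R :=
  (∑ W : Finset V, Ssig p ends a₁ a₂ v b W *
      RootEdge.SFg p ends o a₁ a₂ v (gamma0 p ends o a₁ a₂) W / mW p ends a₁ a₂ v W) -
    (∑ W : Finset V, Ssig p ends a₁ a₂ v b W) *
      (∑ W : Finset V, RootEdge.SFg p ends o a₁ a₂ v (gamma0 p ends o a₁ a₂) W) /
      prob p (avoidAll ends a₂ {a₁}) -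
    (∑ W ∈ fibresA a₁ a₂, Su p ends a₁ a₂ v b W * Su p ends a₁ a₂ v o W / mW p ends a₁ a₂ v W) +
    ((∑ W ∈ fibresA a₁ a₂, Su p ends a₁ a₂ v b W) * LeafStep.mU p ends a₁ a₂ o +
        (∑ W ∈ fibresA a₁ a₂, Su p ends a₁ a₂ v o W) * LeafStep.mU p ends a₁ a₂ b) /
      prob p (avoidAll ends a₂ {a₁}) -
    prob p (PDEvent ends a₁ a₂ v) * LeafStep.mU p ends a₁ a₂ b * LeafStep.mU p ends a₁ a₂ o /
      prob p (avoidAll ends a₂ {a₁}) ^ 2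

/-- **(FM) at `v`**: `0 ≤ FMfun` (census-true: FULL `n = 5`, 0 / 368,640; climbs `n ≤ 8`, 0 / 206,862;
NIGHT1-G30.md §4). -/
def FM (p : E → R) (ends : E → Sym2 V) (o a₁ a₂ v b : V) : Prop := 0 ≤ FMfun p ends o a₁ a₂ v b

end FMDefs

/-! ## The centring is affine -/

section Affine

variable {V : Type*} {E : Type*} [Fintype V] [DecidableEq V] [Fintype E] [DecidableEq E]
  {R : Type*} [Field R] [LinearOrder R] [IsStrictOrderedRing R]

/-- The ratio sum is affine in the centring `γ`: `∑ Sb·SFg(γ)/m_W = ∑ Sb·SFg(0)/m_W + γ ∑ s3·Sb`. -/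
lemma sum_term_SFg_affine {p : E → R} (hp : IsProbVec p) (ends : E → Sym2 V) (o a₁ a₂ v b : V)
    (γ : R) :
    ∑ W : Finset V, Ssig p ends a₁ a₂ v b W * RootEdge.SFg p ends o a₁ a₂ v γ W / mW p ends a₁ a₂ v W =
      (∑ W : Finset V, Ssig p ends a₁ a₂ v b W * RootEdge.SFg p ends o a₁ a₂ v 0 W /
          mW p ends a₁ a₂ v W) +
        γ * ∑ W : Finset V, s3 a₁ a₂ W * Ssig p ends a₁ a₂ v b W := by
  rw [Finset.mul_sum, ← Finset.sum_add_distrib]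
  refine Finset.sum_congr rfl fun W _ => ?_
  unfold RootEdge.SFg
  by_cases hm : mW p ends a₁ a₂ v W = 0
  · rw [hm, Ssig_eq_zero_of_mW_eq_zero hp ends a₁ a₂ v b W hm]
    ring
  · field_simp
    ring

omit [LinearOrder R] [IsStrictOrderedRing R] in
/-- The `F`-sum is affine in the centring `γ`: `∑ SFg(γ) = ∑ SFg(0) + γ ∑ s3·m_W`. -/
lemma sum_SFg_affine (p : E → R) (ends : E → Sym2 V) (o a₁ a₂ v : V) (γ : R) :
    ∑ W : Finset V, RootEdge.SFg p ends o a₁ a₂ v γ W =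
      (∑ W : Finset V, RootEdge.SFg p ends o a₁ a₂ v 0 W) +
        γ * ∑ W : Finset V, s3 a₁ a₂ W * mW p ends a₁ a₂ v W := by
  rw [Finset.mul_sum, ← Finset.sum_add_distrib]
  refine Finset.sum_congr rfl fun W _ => ?_
  unfold RootEdge.SFg
  ring

end Affine

/-! ## The leaf expansion of `btw` and the class theorem -/

section Main

variable {V : Type*} {E : Type*} [Fintype V] [DecidableEq V] [Fintype E] [DecidableEq E]
  {R : Type*} [Field R] [LinearOrder R] [IsStrictOrderedRing R]
  {ends : E → Sym2 V} {f : E} {a₃ v : V}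

/-- **The leaf expansion of (MEANS-a₃) at an attachment vertex `v`**: for `a₃` a leaf at `v` through
`f` of weight `t = p f`, `p₁ = p[f ↦ 1]`, `D = P(PD) ≠ 0` and `s = (1 − t) P(Q) / D`,

  `btw(a₃) = t · ((1 − s) · btw(v at p₁) + s · FMfun(v at p₁))`

— affine in the mixing parameter `s ∈ [0, 1]` between (MEANS-a₃) at `v` (`s = 0`, i.e. `t = 1`) and the
first-order functional (FM) at `v` (`s = 1`, the `t → 0` limit). -/
theorem btw_leaf_free {p : E → R} (hp : IsProbVec p) (hf : ends f = s(a₃, v))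
    (hleaf : ∀ e, a₃ ∈ ends e → e = f) (h3v : a₃ ≠ v) {o a₁ a₂ b : V} (h31 : a₃ ≠ a₁) (h32 : a₃ ≠ a₂)
    (ho : o ≠ a₃) (hb : b ≠ a₃) (hD : prob p (PDEvent ends a₁ a₂ a₃) ≠ 0) :
    btw p ends o a₁ a₂ a₃ b =
      p f * ((1 - (1 - p f) * prob p (avoidAll ends a₂ {a₁}) / prob p (PDEvent ends a₁ a₂ a₃)) *
          btw (Function.update p f 1) ends o a₁ a₂ v b +
        (1 - p f) * prob p (avoidAll ends a₂ {a₁}) / prob p (PDEvent ends a₁ a₂ a₃) *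
          FMfun (Function.update p f 1) ends o a₁ a₂ v b) := by
  have hp₁ : IsProbVec (Function.update p f 1) := hp.update f zero_le_one le_rfl
  have hQ1 : prob (Function.update p f 1) (avoidAll ends a₂ {a₁}) = prob p (avoidAll ends a₂ {a₁}) :=
    HMFPendantRoot.prob_update_one_of_free p (free_Q hf hleaf h3v h31 h32)
  have hfree : ∀ x, x ≠ a₃ → ∀ r, r ≠ a₃ →
      prob (Function.update p f 1) (avoidAll ends a₂ {a₁} ∩ connEvent ends r x) =
        prob p (avoidAll ends a₂ {a₁} ∩ connEvent ends r x) := fun x hx r hr =>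
    HMFPendantRoot.prob_update_one_of_free p
      ((free_Q hf hleaf h3v h31 h32).inter (free_connEvent hf hleaf h3v hr hx))
  have hQpos : prob p (avoidAll ends a₂ {a₁}) ≠ 0 := by
    intro h0
    apply hD
    exact le_antisymm (h0 ▸ prob_PD_le_Q hp ends a₁ a₂ a₃) (prob_nonneg hp _)
  have hDsplit := prob_PD_leaf_free p hf hleaf h3v h31 h32
  rw [mW_singleton_leaf p hf hleaf h3v h31 h32] at hDsplit
  have hDo : Do p ends o a₁ a₂ a₃ = Su p ends a₁ a₂ a₃ o {a₃} +
      p f * ∑ W ∈ fibresA a₁ a₂, Su (Function.update p f 1) ends a₁ a₂ v o W := by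
    rw [Do_eq_fibresA, sum_SuA_leaf hp hf hleaf h3v h31 h32 o]
  have hγ : gamma p ends o a₁ a₂ a₃ =
      ((prob p (avoidAll ends a₂ {a₁} ∩ connEvent ends a₁ o) +
          prob p (avoidAll ends a₂ {a₁} ∩ connEvent ends a₂ o)) * (1 - p f) +
        p f * ∑ W ∈ fibresA a₁ a₂, Su (Function.update p f 1) ends a₁ a₂ v o W) /
      (prob p (avoidAll ends a₂ {a₁}) * (1 - p f) +
        p f * prob (Function.update p f 1) (PDEvent ends a₁ a₂ v)) := by
    unfold gamma
    rw [hDo, hDsplit, Su_singleton_leaf p hf hleaf h3v h31 h32 ho]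
  have hA : ∑ W : Finset V, Ssig (Function.update p f 1) ends a₁ a₂ v b W =
      prob p (avoidAll ends a₂ {a₁} ∩ connEvent ends a₁ b) -
        prob p (avoidAll ends a₂ {a₁} ∩ connEvent ends a₂ b) := by
    rw [← EQo_eq (Function.update p f 1) ends b a₁ a₂ v]
    unfold EQo
    rw [hfree b hb a₁ (Ne.symm h31), hfree b hb a₂ (Ne.symm h32)]
  have hmU : ∀ x, x ≠ a₃ →
      LeafStep.mU (Function.update p f 1) ends a₁ a₂ x = LeafStep.mU p ends a₁ a₂ x := by
    intro x hx
    unfold LeafStep.mU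
    rw [hfree x hx a₁ (Ne.symm h31), hfree x hx a₂ (Ne.symm h32)]
  -- the right-hand side through `btwg` and `FMfun`
  rw [← RootEdge.btwg_gamma (Function.update p f 1) ends o a₁ a₂ v b]
  unfold btw RootEdge.btwg FMfun gamma0
  -- the left-hand side: the leaf splits and the `{a₃}`-fibre
  rw [sum_term_leaf hp hf hleaf h3v o a₁ a₂ b, sum_Ssig_leaf hp hf hleaf h3v a₁ a₂ b,
    sum_SF_leaf hp hf hleaf h3v o a₁ a₂, sum_termA_leaf hp hf hleaf h3v h31 h32 o b,
    sum_SuA_leaf hp hf hleaf h3v h31 h32 b, sum_SuA_leaf hp hf hleaf h3v h31 h32 o,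
    SF_singleton_leaf p h31 h32, mW_singleton_leaf p hf hleaf h3v h31 h32,
    Ssig_singleton_leaf p hf hleaf h3v h31 h32 hb, Ssig_singleton_leaf p hf hleaf h3v h31 h32 ho,
    Su_singleton_leaf p hf hleaf h3v h31 h32 hb, Su_singleton_leaf p hf hleaf h3v h31 h32 ho,
    div_leaf_aux, div_leaf_aux]
  -- the centrings: everything affine in `γ`
  rw [sum_term_SFg_affine hp₁ ends o a₁ a₂ v b (gamma p ends o a₁ a₂ a₃),
    sum_SFg_affine (Function.update p f 1) ends o a₁ a₂ v (gamma p ends o a₁ a₂ a₃),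
    sum_term_SFg_affine hp₁ ends o a₁ a₂ v b (gamma (Function.update p f 1) ends o a₁ a₂ v),
    sum_SFg_affine (Function.update p f 1) ends o a₁ a₂ v (gamma (Function.update p f 1) ends o a₁ a₂ v),
    sum_term_SFg_affine hp₁ ends o a₁ a₂ v b
      (LeafStep.mU (Function.update p f 1) ends a₁ a₂ o /
        prob (Function.update p f 1) (avoidAll ends a₂ {a₁})),
    sum_SFg_affine (Function.update p f 1) ends o a₁ a₂ v
      (LeafStep.mU (Function.update p f 1) ends a₁ a₂ o /
        prob (Function.update p f 1) (avoidAll ends a₂ {a₁}))]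
  rw [hγ]
  unfold gamma
  rw [Do_eq_fibresA (Function.update p f 1) ends o a₁ a₂ v, hA, hQ1, hmU b hb, hmU o ho, hDsplit]
  unfold LeafStep.mU
  rw [hDsplit] at hD
  have hnb0 := sum_Su_fibresA_eq_zero_of_PD_eq_zero hp₁ ends a₁ a₂ v b
  have hno0 := sum_Su_fibresA_eq_zero_of_PD_eq_zero hp₁ ends a₁ a₂ v o
  set P0 := ∑ W : Finset V, Ssig (Function.update p f 1) ends a₁ a₂ v b W *
    RootEdge.SFg (Function.update p f 1) ends o a₁ a₂ v 0 W / mW (Function.update p f 1) ends a₁ a₂ v W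
    with hP0
  set Lb := ∑ W : Finset V, (s3 a₁ a₂ W : R) * Ssig (Function.update p f 1) ends a₁ a₂ v b W with hLb
  set F0 := ∑ W : Finset V, RootEdge.SFg (Function.update p f 1) ends o a₁ a₂ v 0 W with hF0
  set Lm := ∑ W : Finset V, (s3 a₁ a₂ W : R) * mW (Function.update p f 1) ends a₁ a₂ v W with hLm
  set SA := ∑ W ∈ fibresA a₁ a₂, Su (Function.update p f 1) ends a₁ a₂ v b W *
    Su (Function.update p f 1) ends a₁ a₂ v o W / mW (Function.update p f 1) ends a₁ a₂ v W with hSA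
  set nb := ∑ W ∈ fibresA a₁ a₂, Su (Function.update p f 1) ends a₁ a₂ v b W with hnb
  set no := ∑ W ∈ fibresA a₁ a₂, Su (Function.update p f 1) ends a₁ a₂ v o W with hno
  set Dv := prob (Function.update p f 1) (PDEvent ends a₁ a₂ v) with hDvdef
  set Q := prob p (avoidAll ends a₂ {a₁}) with hQdef
  set t := p f with htdef
  set xb := prob p (avoidAll ends a₂ {a₁} ∩ connEvent ends a₁ b) with hxb
  set yb := prob p (avoidAll ends a₂ {a₁} ∩ connEvent ends a₂ b) with hyb
  set xo := prob p (avoidAll ends a₂ {a₁} ∩ connEvent ends a₁ o) with hxo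
  set yo := prob p (avoidAll ends a₂ {a₁} ∩ connEvent ends a₂ o) with hyo
  clear_value P0 Lb F0 Lm SA nb no Dv Q t xb yb xo yo
  set D := Q * (1 - t) + t * Dv with hDdef
  clear_value D
  rcases eq_or_ne Dv 0 with hDv | hDv
  · have hnb' := hnb0 hDv
    have hno' := hno0 hDv
    rw [hDv] at hDdef ⊢
    rw [hnb', hno']
    have h1t : 1 - t ≠ 0 := by
      intro h
      apply hD
      rw [hDdef, h]
      ring
    simp only [mul_zero, add_zero, div_zero, zero_mul, zero_div, sub_zero]
    field_simp
    rw [hDdef]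
    ring
  · field_simp
    rw [hDdef]
    ring

/-- **The pinned leaf rides with `v`**: at `t = p f = 1` (`s = 0`) the leaf expansion reads
`btw(a₃) = btw(v)` — the means-level coincidence of `a₃` and `v`. -/
theorem btw_leaf_of_pf_eq_one {p : E → R} (hp : IsProbVec p) (hf : ends f = s(a₃, v))
    (hleaf : ∀ e, a₃ ∈ ends e → e = f) (h3v : a₃ ≠ v) {o a₁ a₂ b : V} (h31 : a₃ ≠ a₁) (h32 : a₃ ≠ a₂)
    (ho : o ≠ a₃) (hb : b ≠ a₃) (hD : prob p (PDEvent ends a₁ a₂ a₃) ≠ 0) (h1 : p f = 1) :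
    btw p ends o a₁ a₂ a₃ b = btw p ends o a₁ a₂ v b := by
  have h := btw_leaf_free hp hf hleaf h3v h31 h32 ho hb hD
  have hup : Function.update p f 1 = p := by
    conv_lhs => rw [← h1]
    exact Function.update_eq_self f p
  rw [hup, h1] at h
  rw [h]
  ring

/-- **(MEANS-a₃) at a leaf from (MEANS-a₃) at the attachment vertex and (FM) there**: if
`A3Between` holds at `v` under `p[f ↦ 1]` and `0 ≤ FMfun` at `v`, then `A3Between` holds at the leaf `a₃`
for every weight of the leaf edge (the degenerate `D = 0` by `RootEdge.A3Between_of_PD_null`). -/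
theorem A3Between_leaf_free_of {p : E → R} (hp : IsProbVec p) (hf : ends f = s(a₃, v))
    (hleaf : ∀ e, a₃ ∈ ends e → e = f) (h3v : a₃ ≠ v) {o a₁ a₂ b : V} (h31 : a₃ ≠ a₁) (h32 : a₃ ≠ a₂)
    (ho : o ≠ a₃) (hb : b ≠ a₃) (hv : A3Between (Function.update p f 1) ends o a₁ a₂ v b)
    (hFM : 0 ≤ FMfun (Function.update p f 1) ends o a₁ a₂ v b) :
    A3Between p ends o a₁ a₂ a₃ b := by
  rcases eq_or_ne (prob p (PDEvent ends a₁ a₂ a₃)) 0 with hD | hD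
  · exact RootEdge.A3Between_of_PD_null p hp o b hD
  · have hp₁ : IsProbVec (Function.update p f 1) := hp.update f zero_le_one le_rfl
    unfold A3Between
    rw [btw_leaf_free hp hf hleaf h3v h31 h32 ho hb hD]
    have ht0 := hp.nonneg f
    have ht1 := hp.le_one f
    have hQ0 := prob_nonneg hp (avoidAll ends a₂ {a₁})
    have hDpos : 0 < prob p (PDEvent ends a₁ a₂ a₃) :=
      lt_of_le_of_ne (prob_nonneg hp _) (Ne.symm hD)
    have hs0 : 0 ≤ (1 - p f) * prob p (avoidAll ends a₂ {a₁}) / prob p (PDEvent ends a₁ a₂ a₃) :=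
      div_nonneg (mul_nonneg (sub_nonneg.2 ht1) hQ0) hDpos.le
    have hs1 : (1 - p f) * prob p (avoidAll ends a₂ {a₁}) / prob p (PDEvent ends a₁ a₂ a₃) ≤ 1 := by
      rw [div_le_one hDpos, prob_PD_leaf_free p hf hleaf h3v h31 h32,
        mW_singleton_leaf p hf hleaf h3v h31 h32]
      have hDv := prob_nonneg hp₁ (PDEvent ends a₁ a₂ v)
      nlinarith [mul_nonneg ht0 hDv]
    unfold A3Between at hv
    exact mul_nonneg ht0 (add_nonneg (mul_nonneg (sub_nonneg.2 hs1) hv) (mul_nonneg hs0 hFM))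

/-- **(HCOV) at a leaf `a₃` from (MEANS-a₃) ∧ (FM) at the attachment vertex**
(`A3FibreMain.HCov_of_a3Between`). -/
theorem HCov_leaf_free_of {p : E → R} (hp : IsProbVec p) (hf : ends f = s(a₃, v))
    (hleaf : ∀ e, a₃ ∈ ends e → e = f) (h3v : a₃ ≠ v) {o a₁ a₂ b : V} (h31 : a₃ ≠ a₁) (h32 : a₃ ≠ a₂)
    (ho : o ≠ a₃) (hb : b ≠ a₃) (hv : A3Between (Function.update p f 1) ends o a₁ a₂ v b)
    (hFM : 0 ≤ FMfun (Function.update p f 1) ends o a₁ a₂ v b) :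
    HCov p ends o a₁ a₂ a₃ b :=
  HCov_of_a3Between hp ends o a₁ a₂ a₃ b (A3Between_leaf_free_of hp hf hleaf h3v h31 h32 ho hb hv hFM)

end Main

end A3Fibre

end CovForm

end Summit.Ventures.PercRepro2
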